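import Mathlib
import HarnessLib.Audit
import Summits.PneNP.PneNP.Theorems.PstarRankRigidity
import Summits.PneNP.PneNP.Theorems.PstarRankRigidityTwo
import Summits.PneNP.PneNP.Theorems.PstarRankRigidityThree

/-!
# Rank rigidity IV: the elliptic rank-four exception (ROUND-24, memo §10 R7 row (i′) `xy + zw + 1`)

FRONTIER range-avoidance ladder, rung F-N3, ROUND 24 (cell `pnp-ideate`, planner memo `r24/CORE-BOUND-NOTES.md` §4/§9 O4/§10 R7;
restricted-model proof complexity — nothing here bears on `P` versus `NP`).  Sequel of `PstarRankRigidity` I–III.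

The one quadratic `q` of rank `≥ 4` for which a degree-two `g ∉ {0, q}` can vanish on `Z(q)` is the pure ELLIPTIC rank-four shape
(`xy + zw + 1`; memo §4: `(x+y)(z+w)` and its complement in `q`).  Coordinate-free, "pure elliptic rank four" is: radical of codimension `4`
(here: `≥ 4`; codimension `≥ 6` is excluded by `eq_zero_or_eq_of_rank_six`, `5` by `even_rank`) and NEGATIVE bias.  This file proves that the
extra members are exactly what the memo says — BUNDLES:

* `bias_mul_two` — a product `μ₁ μ₂` with dual directions (`a` flips `μ₁`, `b` fixes `μ₁` and flips `μ₂`) has `2·bias = |M|` (three quarters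
  zeros), so `μ₁ μ₂ + 1` has negative bias;
* **`mul_of_elliptic_four`** — if `dim rad B + 4 ≤ dim M` and the quadratic `g` vanishes on `Z(q)` but `g ∉ {0, q}` (which forces the
  elliptic shape), then `g` or
  `q + g` is a PRODUCT OF TWO AFFINE FUNCTIONS `μ₁ μ₂` (hence of rank `≤ 2`, `PstarRankRigidityTwo.finrank_le_rad_symForm`).  Proof: support
  splitting and the second-moment bounds force one of the two pieces to have rank `2` and positive bias; `PstarRankRigidityThree.quad_eq_of_rank_two`
  writes it as `μ₁ μ₂ + κ`, and `κ = 1` would make its bias negative.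

With I–III this completes the R7 case table, recorded as ONE statement **`classification`**: every quadratic `g` vanishing on `Z(q)` (`q`
quadratic, non-constant) is `0`, `q`, a product of two affine functions up to adding `q`, or — only when `Z(q)` is a codimension-two flat —
`(μ₁+1) m₁ + (μ₂+1) m₂`.
-/

set_option linter.dupNamespace false -- `Summit.PneNP.PneNP.…`: summit = sub-problem name (D-0017 single-conjunct layout)

open Finset Module
open Summit.PneNP.PneNP.Theorems.PstarQuadBias (chi chi_zero chi_add chi_add_one chi_of_ne_zero sum_chi_eq_zero_of_shift)
open Summit.PneNP.PneNP.Theorems.PstarCubeIdeals (IsAffineFn IsQuadFn)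
open Summit.PneNP.PneNP.Theorems.PstarQuadRank
open Summit.PneNP.PneNP.Theorems.PstarRankRigidity (two_mul_bias_le eq_zero_or_eq_of_rank_six)
open Summit.PneNP.PneNP.Theorems.PstarCubeIdeals (flips_of_affine)
open Summit.PneNP.PneNP.Theorems.PstarRankRigidityTwo (even_rank eq_zero_or_eq_or_mul_of_translation)
open Summit.PneNP.PneNP.Theorems.PstarRankRigidityThree (bias_eq_zero_of_translation quad_eq_of_rank_two classification_rank_two)

namespace Summit.PneNP.PneNP.Theorems.PstarRankRigidityFour

/-- Every element of `𝔽₂` is `0` or `1`. -/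
private theorem zmod2_cases (t : ZMod 2) : t = 0 ∨ t = 1 := by
  revert t; decide

/-- In `𝔽₂`, `t ≠ 0 ↔ t = 1`. -/
private theorem zmod2_eq_one_of_ne_zero {t : ZMod 2} (h : t ≠ 0) : t = 1 := by
  revert t h; decide

/-- In `𝔽₂`, `x + x = 0`. -/
private theorem zmod2_add_self (x : ZMod 2) : x + x = 0 := by
  revert x; decide

variable {M : Type*} [AddCommGroup M] [Module (ZMod 2) M] [Fintype M] [DecidableEq M]

omit [Fintype M] [DecidableEq M] in
/-- In an `𝔽₂`-module, `u + u = 0`. -/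
private theorem add_self_eq_zero (u : M) : u + u = 0 := by
  rw [← two_smul (ZMod 2) u, show (2 : ZMod 2) = 0 from rfl, zero_smul]

/-! ## The bias of a product with dual directions -/

omit [DecidableEq M] in
/-- **A product `μ₁ μ₂` with dual directions has `2 · bias = |M|`** (three quarters of the points are zeros). -/
theorem bias_mul_two {μ₁ μ₂ : M → ZMod 2} {a b : M} (ha₁ : ∀ x, μ₁ (x + a) = μ₁ x + 1) (hb₁ : ∀ x, μ₁ (x + b) = μ₁ x)
    (hb₂ : ∀ x, μ₂ (x + b) = μ₂ x + 1) : 2 * bias (fun x => μ₁ x * μ₂ x) = 2 ^ finrank (ZMod 2) M := by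
  classical
  -- `Σ χ(μ₁μ₂ (x + b)) = Σ χ(μ₁μ₂ x)`, and pointwise `χ(μ₁μ₂(x+b)) = χ(μ₁μ₂ x) χ(μ₁ x)`
  have hre : ∑ x, chi (μ₁ (x + b) * μ₂ (x + b)) = ∑ x, chi (μ₁ x * μ₂ x) := by
    have hinv : ∀ x ∈ (univ : Finset M), x + b + b = x := fun x _ => by rw [add_assoc, add_self_eq_zero, add_zero]
    exact sum_nbij' (· + b) (· + b) (fun _ _ => mem_univ _) (fun _ _ => mem_univ _) hinv hinv fun _ _ => rfl
  have hpt : ∀ x, chi (μ₁ (x + b) * μ₂ (x + b)) = chi (μ₁ x * μ₂ x) * chi (μ₁ x) := by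
    intro x; rw [hb₁, hb₂, ← chi_add]; congr 1; ring
  -- pointwise: `χ(μ₁μ₂) + χ(μ₁μ₂)χ(μ₁) = 1 + χ(μ₁)`
  have hpt2 : ∀ x, chi (μ₁ x * μ₂ x) + chi (μ₁ x * μ₂ x) * chi (μ₁ x) = 1 + chi (μ₁ x) := by
    intro x
    rcases zmod2_cases (μ₁ x) with h | h <;> rcases zmod2_cases (μ₂ x) with h' | h' <;> rw [h, h'] <;> decide
  have hμ₁ : ∑ x, chi (μ₁ x) = 0 := sum_chi_eq_zero_of_shift univ a (fun _ _ => mem_univ _) μ₁ fun x _ => ha₁ x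
  have hsum : ∑ x, (chi (μ₁ x * μ₂ x) + chi (μ₁ x * μ₂ x) * chi (μ₁ x)) = ∑ x, (1 + chi (μ₁ x)) := sum_congr rfl fun x _ => hpt2 x
  rw [sum_add_distrib, sum_add_distrib, hμ₁, add_zero, ← sum_congr rfl fun x _ => hpt x, hre] at hsum
  unfold bias
  rw [two_mul, hsum, sum_const, Finset.card_univ, nsmul_eq_mul, mul_one, card_eq_pow]

/-! ## The elliptic rank-four exception -/

omit [Fintype M] [DecidableEq M] in
/-- `B + B = 0` for bilinear forms over `𝔽₂`. -/
private theorem bilin_add_self (C : LinearMap.BilinForm (ZMod 2) M) : C + C = 0 := by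
  ext x y; simp only [LinearMap.add_apply, LinearMap.zero_apply]; exact zmod2_add_self _

omit [Fintype M] [DecidableEq M] in
/-- A rank-two piece with positive bias is a product: the `κ = 1` shape `μ₁ μ₂ + 1` has negative bias. -/
private theorem mul_of_rank_two_of_bias_pos [Fintype M] {f : M → ZMod 2} {C : LinearMap.BilinForm (ZMod 2) M}
    (hC : ∀ x w, f (x + w) = f x + f w + f 0 + C x w) {a b : M} (hab : C a b ≠ 0)
    (hrank : finrank (ZMod 2) M ≤ finrank (ZMod 2) (rad C) + 2) (hpos : 0 < bias f) :
    ∃ μ₁ μ₂ : M → ZMod 2, IsAffineFn μ₁ ∧ IsAffineFn μ₂ ∧ ∀ x, f x = μ₁ x * μ₂ x := by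
  classical
  have hab1 : C a b = 1 := zmod2_eq_one_of_ne_zero hab
  have halt := polar_self hC
  have hsymm := polar_symm hC
  -- positive bias ⇒ no translation direction ⇒ `f` constant on the radical
  have hinv : ∀ r ∈ rad C, f r = f 0 := by
    intro r hr
    by_contra hne
    have hr1 : f r + f 0 = 1 := by
      rcases zmod2_cases (f r) with e | e <;> rcases zmod2_cases (f 0) with e' | e' <;> rw [e, e'] at hne ⊢ <;>
        first | exact absurd rfl hne | decide
    have htr : ∀ x, f (x + r) = f x + 1 := by
      intro x; rw [hC, hsymm, mem_rad.1 hr x, add_zero, add_assoc, hr1]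
    have := bias_eq_zero_of_translation (q := f) htr
    omega
  have hq := quad_eq_of_rank_two hC hab1 hrank hinv
  -- the two affine factors and their dual directions
  have hμ₁ : IsAffineFn (fun x => C x b + (f b + f 0)) := by
    intro x w; show C (x + w) b + (f b + f 0) = (C x b + (f b + f 0)) + (C w b + (f b + f 0)) + (C 0 b + (f b + f 0))
    rw [map_add, LinearMap.add_apply, LinearMap.map_zero, LinearMap.zero_apply]
    generalize (C x) b = U; generalize (C w) b = U'; generalize f b + f 0 = A; revert U U' A; decide
  have hμ₂ : IsAffineFn (fun x => C x a + (f a + f 0)) := by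
    intro x w; show C (x + w) a + (f a + f 0) = (C x a + (f a + f 0)) + (C w a + (f a + f 0)) + (C 0 a + (f a + f 0))
    rw [map_add, LinearMap.add_apply, LinearMap.map_zero, LinearMap.zero_apply]
    generalize (C x) a = U; generalize (C w) a = U'; generalize f a + f 0 = A; revert U U' A; decide
  rcases zmod2_cases ((f a + f 0) * (f b + f 0) + f 0) with hκ | hκ
  · exact ⟨_, _, hμ₁, hμ₂, fun x => by rw [hq x, hκ, add_zero]⟩
  · -- `κ = 1`: bias would be negative
    exfalso
    have ha₁ : ∀ x, C (x + a) b + (f b + f 0) = (C x b + (f b + f 0)) + 1 := by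
      intro x; rw [map_add, LinearMap.add_apply, hab1]; ring
    have hb₁ : ∀ x, C (x + b) b + (f b + f 0) = C x b + (f b + f 0) := by
      intro x; rw [map_add, LinearMap.add_apply, halt b, add_zero]
    have hb₂ : ∀ x, C (x + b) a + (f a + f 0) = (C x a + (f a + f 0)) + 1 := by
      intro x; rw [map_add, LinearMap.add_apply, hsymm b a, hab1]; ring
    have hprod := bias_mul_two (μ₁ := fun x => C x b + (f b + f 0)) (μ₂ := fun x => C x a + (f a + f 0)) ha₁ hb₁ hb₂
    -- `bias f = - bias (μ₁ μ₂)`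
    have hneg : bias f = -bias (fun x => (C x b + (f b + f 0)) * (C x a + (f a + f 0))) := by
      unfold bias
      rw [← sum_neg_distrib]
      refine sum_congr rfl fun x _ => ?_
      rw [hq x, hκ, chi_add_one]
    have hpow : (0 : ℤ) < 2 ^ finrank (ZMod 2) M := by positivity
    linarith

/-- **Rank rigidity, the elliptic rank-four exception.**  If the polar form of `q` has radical of codimension `≥ 4` and the quadratic `g`
vanishes on `Z(q)` without being `0` or `q`, then `g` or `q + g` is a product of two affine functions.  (By `eq_zero_or_eq_of_bias_pos` /
`eq_zero_or_eq_of_rank_six` / `even_rank` this can only happen for the pure elliptic rank-four shape; the sign of `bias q` is not even needed.) -/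
theorem mul_of_elliptic_four {q g : M → ZMod 2} {B : LinearMap.BilinForm (ZMod 2) M} (hB : ∀ x w, q (x + w) = q x + q w + q 0 + B x w)
    (hrank : finrank (ZMod 2) (rad B) + 4 ≤ finrank (ZMod 2) M) (hg : IsQuadFn g) (hZ : ∀ x, q x = 0 → g x = 0)
    (h1 : ¬ ∀ x, g x = 0) (h2 : ¬ ∀ x, g x = q x) :
    ∃ μ₁ μ₂ : M → ZMod 2, IsAffineFn μ₁ ∧ IsAffineFn μ₂ ∧ ((∀ x, g x = μ₁ x * μ₂ x) ∨ (∀ x, q x + g x = μ₁ x * μ₂ x)) := by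
  classical
  -- the radical has codimension exactly `4`
  have h6 : ¬ finrank (ZMod 2) (rad B) + 6 ≤ finrank (ZMod 2) M := fun h =>
    (eq_zero_or_eq_of_rank_six hB h hg hZ).elim h1 h2
  obtain ⟨n, hn⟩ := even_rank hB
  set V := finrank (ZMod 2) M with hV
  set d := finrank (ZMod 2) (rad B) with hd
  have hd4 : d + 4 = V := by omega
  -- powers of two: `2^V = 16 P`, `P = 2^d`
  set P : ℤ := 2 ^ d with hP
  have hP1 : 1 ≤ P := one_le_pow₀ (by norm_num)
  have e16 : (2 : ℤ) ^ V = 16 * P := by rw [← hd4, pow_add, hP]; ring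
  -- the polar form of `g` and of `q + g`
  obtain ⟨C, hC⟩ := hg
  have hC' : ∀ x w, (fun x => q x + g x) (x + w) = (fun x => q x + g x) x + (fun x => q x + g x) w + (fun x => q x + g x) 0 + (B + C) x w := by
    intro x w; simp only [LinearMap.add_apply]; rw [hB, hC]; ring
  -- `q` has a zero (its bias is not `|M|`... simply: `bias q < 0 < |M|` rules out `q ≡ 1`? no — `q ≡ 1` HAS negative bias; use the rank)
  have hBne : ∃ a b, B a b ≠ 0 := by
    by_contra hno; push Not at hno
    have htop : rad B = ⊤ := by rw [eq_top_iff]; intro x _; rw [mem_rad]; exact hno x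
    have : d = V := by rw [hd, htop, finrank_top]
    omega
  obtain ⟨a₀, b₀, hab₀⟩ := hBne
  have hx₀ : ∃ x₀, q x₀ = 0 := by
    by_contra hno; push Not at hno
    have hone : ∀ x, q x = q 0 := fun x => by rw [zmod2_eq_one_of_ne_zero (hno x), zmod2_eq_one_of_ne_zero (hno 0)]
    exact hab₀ (polar_eq_zero_of_const hB hone a₀ b₀)
  obtain ⟨x₀, hx₀⟩ := hx₀
  -- both pieces take both values
  push Not at h1 h2
  obtain ⟨x₁, hx₁⟩ := h1
  obtain ⟨x₂, hx₂⟩ := h2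
  have hg₀ : g x₀ = 0 := hZ x₀ hx₀
  have hv : ∃ v, g v ≠ g 0 := by
    by_cases h : g 0 = 0
    · exact ⟨x₁, by rw [h]; exact hx₁⟩
    · exact ⟨x₀, by rw [hg₀]; exact Ne.symm h⟩
  have hv' : ∃ v, (fun x => q x + g x) v ≠ (fun x => q x + g x) 0 := by
    have e₀ : q x₀ + g x₀ = 0 := by rw [hx₀, hg₀, add_zero]
    have e₂ : q x₂ + g x₂ ≠ 0 := by
      intro e; apply hx₂
      rcases zmod2_cases (q x₂) with a | a <;> rcases zmod2_cases (g x₂) with b | b <;> rw [a, b] at e ⊢ <;>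
        first | rfl | exact absurd e (by decide)
    by_cases h : q 0 + g 0 = 0
    · exact ⟨x₂, by show q x₂ + g x₂ ≠ q 0 + g 0; rw [h]; exact e₂⟩
    · exact ⟨x₀, by show q x₀ + g x₀ ≠ q 0 + g 0; rw [e₀]; exact Ne.symm h⟩
  obtain ⟨v, hv⟩ := hv
  obtain ⟨v', hv'⟩ := hv'
  -- biases
  have e := bias_add_card_eq (M := M) hZ
  have b1 := two_mul_bias_le hC hv
  have b2 := two_mul_bias_le (f := fun x => q x + g x) hC' hv'
  have sq := bias_sq_le_pow (M := M) hB
  have sg := bias_sq_le_pow (M := M) hC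
  have sg' := bias_sq_le_pow (M := M) (f := fun x => q x + g x) hC'
  rw [← hV] at e b1 b2 sq sg sg'
  set dg := finrank (ZMod 2) (rad C) with hdg
  set dg' := finrank (ZMod 2) (rad (B + C)) with hdg'
  -- `|bias q| ≤ 4P`
  have hq4 : -(4 * P) ≤ bias q := by
    have h1' : bias q ^ 2 ≤ (4 * P) ^ 2 := by
      calc bias q ^ 2 ≤ 2 ^ (V + d) := sq
        _ = (4 * P) ^ 2 := by rw [← hd4, hP]; ring
    have := abs_le_of_sq_le_sq' h1' (by positivity)
    linarith [this.1]
  have hgpos : 4 * P ≤ bias g := by linarith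
  have hg'pos : 4 * P ≤ bias (fun x => q x + g x) := by linarith
  -- the forms of the pieces are non-zero (else the piece would be balanced)
  have hCne : ∃ a b, C a b ≠ 0 := by
    by_contra hno; push Not at hno
    have := bias_eq_zero_of_affine (isAffineFn_of_polar_zero hC hno) hv
    linarith
  have hC'ne : ∃ a b, (B + C) a b ≠ 0 := by
    by_contra hno; push Not at hno
    have := bias_eq_zero_of_affine (m := fun x => q x + g x) (isAffineFn_of_polar_zero hC' hno) hv'
    linarith
  obtain ⟨a, b, hab⟩ := hCne
  obtain ⟨a', b', hab'⟩ := hC'ne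
  -- parity and subadditivity of the radicals
  obtain ⟨n₁, hn₁⟩ := even_rank hC
  obtain ⟨n₂, hn₂⟩ := even_rank (q := fun x => q x + g x) hC'
  rw [← hV] at hn₁ hn₂
  have hsub : dg + dg' ≤ V + d := by
    have h := finrank_rad_add_le (M := M) C (B + C)
    have hBC : C + (B + C) = B := by rw [← add_assoc, add_comm C B, add_assoc, bilin_add_self, add_zero]
    rw [hBC] at h
    exact h
  -- one of the pieces has rank two
  have hcase : V ≤ dg + 2 ∨ V ≤ dg' + 2 := by
    by_contra hno
    push Not at hno
    obtain ⟨hno1, hno2⟩ := hno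
    have hdg4 : dg + 4 ≤ V := by omega
    have hdg'4 : dg' + 4 ≤ V := by omega
    have x4 : bias g ≤ 4 * P := by
      have h1' : bias g ^ 2 ≤ (4 * P) ^ 2 := by
        calc bias g ^ 2 ≤ 2 ^ (V + dg) := sg
          _ ≤ 2 ^ (d + 4 + d) := pow_le_pow_right₀ (by norm_num) (by omega)
          _ = (4 * P) ^ 2 := by rw [hP]; ring
      exact (abs_le_of_sq_le_sq' h1' (by positivity)).2
    have y4 : bias (fun x => q x + g x) ≤ 4 * P := by
      have h1' : bias (fun x => q x + g x) ^ 2 ≤ (4 * P) ^ 2 := by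
        calc bias (fun x => q x + g x) ^ 2 ≤ 2 ^ (V + dg') := sg'
          _ ≤ 2 ^ (d + 4 + d) := pow_le_pow_right₀ (by norm_num) (by omega)
          _ = (4 * P) ^ 2 := by rw [hP]; ring
      exact (abs_le_of_sq_le_sq' h1' (by positivity)).2
    linarith
  rcases hcase with hr | hr
  · obtain ⟨μ₁, μ₂, hμ₁, hμ₂, hμ⟩ := mul_of_rank_two_of_bias_pos hC hab (by rw [← hV, ← hdg]; exact hr) (by linarith)
    exact ⟨μ₁, μ₂, hμ₁, hμ₂, Or.inl hμ⟩
  · obtain ⟨μ₁, μ₂, hμ₁, hμ₂, hμ⟩ :=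
      mul_of_rank_two_of_bias_pos (f := fun x => q x + g x) hC' hab' (by rw [← hV, ← hdg']; exact hr) (by linarith)
    exact ⟨μ₁, μ₂, hμ₁, hμ₂, Or.inr hμ⟩

/-! ## The umbrella classification -/

/-- **Classification of the degree-two ideal of `Z(q)`** (the whole R7 case table in one statement).  Let `q` be a non-constant quadratic
function (polar form `B`) and `g` a quadratic function vanishing on `Z(q)`.  Then one of:
(A) `g = 0` or `g = q`;
(B) `g` or `q + g` is a product of two affine functions (so has rank `≤ 2`, `PstarRankRigidityTwo.finrank_le_rad_symForm`);
(C) `q = μ₁ μ₂ + 1` with `μ₁ = B(·) b + q b + q 0`, `μ₂ = B(·) a + q a + q 0` for some `a, b` with `B a b = 1` — `Z(q)` is the codimension-two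
    NOR flat `{μ₁ = μ₂ = 1}` — and `g = (μ₁ + 1)·m₁ + (μ₂ + 1)·m₂` with `m₁, m₂` affine. -/
theorem classification {q g : M → ZMod 2} {B : LinearMap.BilinForm (ZMod 2) M} (hB : ∀ x w, q (x + w) = q x + q w + q 0 + B x w)
    (hq : ∃ v, q v ≠ q 0) (hg : IsQuadFn g) (hZ : ∀ x, q x = 0 → g x = 0) :
    ((∀ x, g x = 0) ∨ (∀ x, g x = q x)) ∨
    (∃ μ₁ μ₂ : M → ZMod 2, IsAffineFn μ₁ ∧ IsAffineFn μ₂ ∧ ((∀ x, g x = μ₁ x * μ₂ x) ∨ (∀ x, q x + g x = μ₁ x * μ₂ x))) ∨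
    (∃ a b : M, B a b = 1 ∧ (∀ x, q x = (B x b + (q b + q 0)) * (B x a + (q a + q 0)) + 1) ∧
      ∃ m₁ m₂ : M → ZMod 2, IsAffineFn m₁ ∧ IsAffineFn m₂ ∧
        ∀ x, g x = (B x b + (q b + q 0) + 1) * m₁ x + (B x a + (q a + q 0) + 1) * m₂ x) := by
  classical
  by_cases htr : ∃ r, ∀ x, q (x + r) = q x + 1
  · -- translation type, any rank
    obtain ⟨r, hr⟩ := htr
    rcases eq_zero_or_eq_or_mul_of_translation hB hr hg hZ with h | h | ⟨α, β, hα, hβ, h⟩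
    · exact Or.inl (Or.inl h)
    · exact Or.inl (Or.inr h)
    · exact Or.inr (Or.inl ⟨α, β, hα, hβ, Or.inl h⟩)
  · -- no translation direction: `q` is constant on the radical, and `B ≠ 0`
    push Not at htr
    have hinv : ∀ r ∈ rad B, q r = q 0 := by
      intro r hr
      by_contra hne
      have hr1 : q r + q 0 = 1 := by
        rcases zmod2_cases (q r) with e | e <;> rcases zmod2_cases (q 0) with e' | e' <;> rw [e, e'] at hne ⊢ <;>
          first | exact absurd rfl hne | decide
      obtain ⟨x, hx⟩ := htr r
      exact hx (by rw [hB, polar_symm hB, mem_rad.1 hr x, add_zero, add_assoc, hr1])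
    have hBne : ∃ a b, B a b ≠ 0 := by
      by_contra hno; push Not at hno
      obtain ⟨v, hv⟩ := hq
      obtain ⟨x, hx⟩ := htr v
      exact hx (flips_of_affine (isAffineFn_of_polar_zero hB hno) hv x)
    obtain ⟨a, b, hab⟩ := hBne
    have hab1 : B a b = 1 := zmod2_eq_one_of_ne_zero hab
    have h2 := finrank_rad_add_two_le (polar_self hB) (polar_symm hB) hab
    by_cases hr2 : finrank (ZMod 2) M ≤ finrank (ZMod 2) (rad B) + 2
    · -- rank two: OR-set or NOR flat
      rcases classification_rank_two hB hab1 hr2 hinv hg hZ with ⟨-, h⟩ | ⟨hq1, m₁, m₂, hm₁, hm₂, h⟩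
      · exact Or.inl h
      · exact Or.inr (Or.inr ⟨a, b, hab1, hq1, m₁, m₂, hm₁, hm₂, h⟩)
    · -- rank at least four (parity): rigid, or the elliptic bundle
      obtain ⟨n, hn⟩ := even_rank hB
      have h4 : finrank (ZMod 2) (rad B) + 4 ≤ finrank (ZMod 2) M := by omega
      by_cases hA : (∀ x, g x = 0) ∨ (∀ x, g x = q x)
      · exact Or.inl hA
      · push Not at hA
        obtain ⟨μ₁, μ₂, hμ₁, hμ₂, h⟩ := mul_of_elliptic_four hB h4 hg hZ (by simpa using hA.1) (by simpa using hA.2)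
        exact Or.inr (Or.inl ⟨μ₁, μ₂, hμ₁, hμ₂, h⟩)

end Summit.PneNP.PneNP.Theorems.PstarRankRigidityFour
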